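import Summits.CriticalPhenomena.CardyFormulaZ2.Theorems.CardyUniqueLimitCardyRigiditySlitCrossingFreezing
import Summits.CriticalPhenomena.CardyFormulaZ2.Theorems.CardyUniqueLimitCardyRigidityPercFreshArmG2
import HarnessLib

/-!
# Conditioning on the exploration stopped at a class step: the single-scale closing bound

Crux `Summit.CriticalPhenomena.CardyFormulaZ2.Theses.CardyUniqueLimit.CardyRigidity`
(stmt-CriticalPhenomena-0746), line `crossing_martingale`, in support of the registered stub A3b
`stub_slitObservableApprox` (NOT proved here); probabilistic skeleton for the sub-goal
`Regularity.PercExplorationULC` (`…ExplorationULC.lean`) and for every "condition on the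
exploration prefix, then Russo–Seymour–Welsh in the fresh territory" step (Camia–Newman, PTRF 139
(2007), proof of Lemma 7.1: "the conditional probability (conditioned on `Γ(γ)` at time `T`) to
find a yellow lateral crossing … is bounded below by the probability to find a yellow circuit in
an annulus"; Kemppainen–Smirnov 2017, §4.2).  Everything here is PROVED:

* `measure_preimage_inter_le_mul_of_fresh` — decoupling over the fibres of a discrete past for
  an ARBITRARY family of fresh events (determined by the unrevealed edges): the template
  `measure_preimage_inter_le_mul_of_freshArm` of `…PercFreshArmG2.lean` with the fresh-arm event
  replaced by any `F d`;
* `measure_preimage_inter_le_mul_of_closing` — the COMPLEMENTARY ("closing") form: if on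
  `{pref ∈ T}` the event `E` forces the ABSENCE of a fresh event `G (pref ω)` of probability
  `≥ q`, then `P ({pref ∈ T} ∩ E) ≤ (1 - q) · P {pref ∈ T}`;
* the past STOPPED AT A CLASS STEP `ν` (`{ν ≤ m}` a class event of `C_m`, the convention of
  `Freezing.percSlitExpectation_frozen`): `stoppedPrefix D ν ω = explorationPrefix D (ν ω) ω`;
  its fibres are the stopped prefix events `C_{ν ω₀}(ω₀)` (`preimage_stoppedPrefix_singleton`),
  measurable and determined by the revealed free edges `revealedFreeEdges hD ω₀ (ν ω₀)`;
* `measure_inter_le_mul_of_closing_classStep` — **the single-scale conditional closing bound**: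
  for a class step `ν`, a set `T` of stopped prefixes and a closing event `G ω₀` that is a class
  function of the stopped past, determined by the edges NOT revealed by it, of probability `≥ q`
  whenever the stopped prefix is in `T`: if `E` forces `ω ∉ G ω` on `{stoppedPrefix ∈ T}` then
  `P ({stoppedPrefix ∈ T} ∩ E) ≤ (1 - q) · P {stoppedPrefix ∈ T}`;
* `measure_le_pow_mul_of_forall_succ_le` — the multi-scale iteration
  `P (B J) ≤ (1 - q)^J · P (B 0)` from `P (B (j+1)) ≤ (1 - q) · P (B j)`.

What these do NOT give (see the report of worker W7): the deterministic input "no closing at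
scale `j` ⇒ absence of a fresh closing structure off the revealed edges" for the fjords of the
slit components, and the fact that for FIXED `ε''` the number of scales between `ε''` and `ε`
only yields `(ε''/ε)^c`, which beats the `(1/ε'')²` possible locations only with the six-arm
exponent `> 2` (Camia–Newman's Lemma 6.1) — the iteration here serves the boundary case of their
Lemma 7.1 (stopped exploration) and corridor estimates.

References: F. Camia, C. M. Newman, Probab. Theory Relat. Fields 139 (2007), proof of Lemma 7.1
[CamiaNewman2007]; A. Kemppainen, S. Smirnov, Ann. Probab. 45 (2017), §4.2 [KemppainenSmirnov2017];
O. Schramm, S. Smirnov, Ann. Probab. 39 (2011), proof of Lemma 6.1 [SchrammSmirnov2011].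
-/

noncomputable section

open MeasureTheory Set Filter
open scoped ENNReal
open Literature.Probability Literature.Probability.LatticeModels Literature.Probability.Percolation
open Literature.Probability.LatticeModels.DiscreteDobrushin
open Summit.CriticalPhenomena.CardyFormulaZ2.Cruxes.ParafermionToSLESixFamilies.CaratheodoryNetSlitUniformity
  (revealedFreeEdges determinedBy_explorationCylinder revealedFreeEdges_eq_of_mem)

namespace Summit.CriticalPhenomena.CardyFormulaZ2.Cruxes.CardyRigidity.CrossingMartingale

namespace Regularity

/-! ### Decoupling over the fibres of a discrete past, arbitrary fresh events -/

/-- **Decoupling over the values of a discrete past, for arbitrary fresh events** (domain Markov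
property in integrated form).  Let `pref` be a discrete past with countably many values, whose
fibres `{pref = d}` are measurable and determined by revealed edge sets `Rev d`, and let `F d` be
measurable events determined by the unrevealed edges `(Rev d)ᶜ`.  If on `{pref ∈ T}` the event `E`
forces `ω ∈ F (pref ω)` and `c` bounds `P (F d)` for `d ∈ T`, then
`P ({pref ∈ T} ∩ E) ≤ c · P {pref ∈ T}` (each fibre is independent of its fresh event,
`bondPercolation_inter_of_disjoint`). [cite: SchrammSmirnov2011, proof of Lemma 6.1]
[cite: KemppainenSmirnov2017, §4.2 (proof of Prop. 4.7)] -/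
theorem measure_preimage_inter_le_mul_of_fresh {κ : Type*} [Countable κ]
    (pref : BondConfig (Site 2) → κ) (Rev : κ → Set (Sym2 (Site 2)))
    (hmeas : ∀ d, MeasurableSet (pref ⁻¹' {d})) (hdet : ∀ d, DeterminedBy (pref ⁻¹' {d}) (Rev d))
    (F : κ → Set (BondConfig (Site 2))) (hFdet : ∀ d, DeterminedBy (F d) (Rev d)ᶜ)
    (hFm : ∀ d, MeasurableSet (F d)) {T : Set κ} {E : Set (BondConfig (Site 2))} {c : ℝ≥0∞}
    (hE : ∀ ω ∈ E, pref ω ∈ T → ω ∈ F (pref ω)) (hc : ∀ d ∈ T, bondPercolation (zdGraph 2) half (F d) ≤ c) :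
    bondPercolation (zdGraph 2) half (pref ⁻¹' T ∩ E) ≤
      c * bondPercolation (zdGraph 2) half (pref ⁻¹' T) := by
  set P := bondPercolation (zdGraph 2) half with hP
  have hsub : pref ⁻¹' T ∩ E ⊆ ⋃ d ∈ T, pref ⁻¹' {d} ∩ F d := by
    rintro ω ⟨hT, hωE⟩
    exact Set.mem_biUnion hT ⟨rfl, hE ω hωE hT⟩
  have hdisj : T.PairwiseDisjoint fun d ↦ pref ⁻¹' {d} := fun d _ d' _ hne ↦
    Set.disjoint_left.2 fun ω (h : pref ω = d) (h' : pref ω = d') ↦ hne (h.symm.trans h')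
  have hprod : ∀ d ∈ T, P (pref ⁻¹' {d} ∩ F d) = P (pref ⁻¹' {d}) * P (F d) := fun d _ ↦
    bondPercolation_inter_of_disjoint (zdGraph 2) half disjoint_compl_right (hdet d) (hFdet d)
      (hmeas d) (hFm d)
  have key := measure_le_mul_of_forall_inter_eq_mul P (Set.to_countable T) hsub
    (fun d _ ↦ hmeas d) hdisj hprod (c := c) hc
  rwa [Set.biUnion_preimage_singleton] at key

/-- **The closing form of the decoupling.**  With `pref`, `Rev` as above, let `G d` be measurable
"closing" events determined by the unrevealed edges `(Rev d)ᶜ`, of probability `≥ q` for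
`d ∈ T`.  If on `{pref ∈ T}` the event `E` forces the ABSENCE of `G (pref ω)`, then
`P ({pref ∈ T} ∩ E) ≤ (1 - q) · P {pref ∈ T}` — "at this scale the fjord is closed with
conditional probability at least `q`". [cite: CamiaNewman2007, §7 (proof of Lemma 7.1)] -/
theorem measure_preimage_inter_le_mul_of_closing {κ : Type*} [Countable κ]
    (pref : BondConfig (Site 2) → κ) (Rev : κ → Set (Sym2 (Site 2)))
    (hmeas : ∀ d, MeasurableSet (pref ⁻¹' {d})) (hdet : ∀ d, DeterminedBy (pref ⁻¹' {d}) (Rev d))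
    (G : κ → Set (BondConfig (Site 2))) (hGdet : ∀ d, DeterminedBy (G d) (Rev d)ᶜ)
    (hGm : ∀ d, MeasurableSet (G d)) {T : Set κ} {E : Set (BondConfig (Site 2))} {q : ℝ≥0∞}
    (hq : ∀ d ∈ T, q ≤ bondPercolation (zdGraph 2) half (G d))
    (hE : ∀ ω ∈ E, pref ω ∈ T → ω ∉ G (pref ω)) :
    bondPercolation (zdGraph 2) half (pref ⁻¹' T ∩ E) ≤
      (1 - q) * bondPercolation (zdGraph 2) half (pref ⁻¹' T) := by
  refine measure_preimage_inter_le_mul_of_fresh pref Rev hmeas hdet (fun d ↦ (G d)ᶜ)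
    (fun d ↦ (hGdet d).compl) (fun d ↦ (hGm d).compl) (fun ω hω hT ↦ hE ω hω hT)
    fun d hd ↦ ?_
  rw [prob_compl_eq_one_sub (hGm d)]
  exact tsub_le_tsub_left (hq d hd) 1

/-- **Multi-scale iteration**: if each step loses the factor `θ`, then after `J` steps
`μ (B J) ≤ θ ^ J · μ (B 0)`. [folklore] -/
theorem measure_le_pow_mul_of_forall_succ_le {Ω : Type*} [MeasurableSpace Ω] (μ : Measure Ω)
    (B : ℕ → Set Ω) {θ : ℝ≥0∞} {J : ℕ} (h : ∀ j < J, μ (B (j + 1)) ≤ θ * μ (B j)) :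
    μ (B J) ≤ θ ^ J * μ (B 0) := by
  induction J with
  | zero => simp
  | succ J ih =>
    calc μ (B (J + 1)) ≤ θ * μ (B J) := h J (Nat.lt_succ_self J)
      _ ≤ θ * (θ ^ J * μ (B 0)) := by gcongr; exact ih fun j hj ↦ h j (hj.trans (Nat.lt_succ_self J))
      _ = θ ^ (J + 1) * μ (B 0) := by ring

/-! ### The past stopped at a class step -/

variable {D : DiscreteDobrushin}

/-- A shorter prefix is the truncation of a longer one. [cite: DuminilCopinSmirnov2012Clay, §6.2] -/
theorem explorationPrefix_eq_take_of_le {m n : ℕ} (hmn : m ≤ n) (ω : BondConfig (Site 2)) :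
    explorationPrefix D m ω = (explorationPrefix D n ω).take (m + 2) :=
  (congrFun (take_comp_explorationPrefix (D := D) hmn) ω).symm

variable (D) in
/-- **The past stopped at the step `ν`**: the exploration prefix of depth `ν ω` of `ω`.
[cite: DuminilCopinSmirnov2012Clay, §6.2 (proof of Prop. 6.7)] -/
def stoppedPrefix (ν : BondConfig (Site 2) → ℕ) (ω : BondConfig (Site 2)) : List MedialVertex :=
  explorationPrefix D (ν ω) ω

variable {hD : D.IsZdAdmissible}

/-- For a class step, equal stopped prefixes have equal stopping values. [folklore] -/
theorem eq_of_stoppedPrefix_eq {ν : BondConfig (Site 2) → ℕ}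
    (hν : ∀ m (ω₀ ω : BondConfig (Site 2)), ω ∈ explorationCylinder hD ω₀ m → (ν ω ≤ m ↔ ν ω₀ ≤ m))
    {ω ω₀ : BondConfig (Site 2)} (h : stoppedPrefix D ν ω = stoppedPrefix D ν ω₀) : ν ω = ν ω₀ := by
  simp only [stoppedPrefix] at h
  rcases le_total (ν ω) (ν ω₀) with hle | hle
  · have hmem : ω ∈ explorationCylinder hD ω₀ (ν ω) := by
      rw [explorationCylinder_eq_preimage_explorationPrefix, mem_preimage, mem_singleton_iff,
        explorationPrefix_eq_take_of_le hle ω₀, ← h, ← explorationPrefix_eq_take_of_le le_rfl ω]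
    exact le_antisymm hle ((hν _ ω₀ ω hmem).1 le_rfl)
  · have hmem : ω₀ ∈ explorationCylinder hD ω (ν ω₀) := by
      rw [explorationCylinder_eq_preimage_explorationPrefix, mem_preimage, mem_singleton_iff,
        explorationPrefix_eq_take_of_le hle ω, h, ← explorationPrefix_eq_take_of_le le_rfl ω₀]
    exact le_antisymm ((hν _ ω ω₀ hmem).1 le_rfl) hle

/-- **The fibres of the stopped past are the stopped prefix events**: for a class step `ν`,
`{stoppedPrefix = stoppedPrefix ω₀} = C_{ν ω₀}(ω₀)`. [cite: DuminilCopinSmirnov2012Clay, §6.2 (proof of Prop. 6.7)] -/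
theorem preimage_stoppedPrefix_singleton {ν : BondConfig (Site 2) → ℕ}
    (hν : ∀ m (ω₀ ω : BondConfig (Site 2)), ω ∈ explorationCylinder hD ω₀ m → (ν ω ≤ m ↔ ν ω₀ ≤ m))
    (ω₀ : BondConfig (Site 2)) :
    stoppedPrefix D ν ⁻¹' {stoppedPrefix D ν ω₀} = explorationCylinder hD ω₀ (ν ω₀) := by
  ext ω
  simp only [mem_preimage, mem_singleton_iff]
  constructor
  · intro h
    have hνeq := eq_of_stoppedPrefix_eq hν h
    rw [explorationCylinder_eq_preimage_explorationPrefix, mem_preimage, mem_singleton_iff]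
    have h' := h
    simp only [stoppedPrefix, hνeq] at h'
    exact h'
  · intro hω
    have hle : ν ω ≤ ν ω₀ := (hν _ ω₀ ω hω).2 le_rfl
    have hmin := Freezing.min_eq_of_mem hν hω
    rw [min_eq_right hle, min_self] at hmin
    rw [explorationCylinder_eq_preimage_explorationPrefix, mem_preimage, mem_singleton_iff] at hω
    simp only [stoppedPrefix, hmin, hω]

/-- The fibres of the stopped past are measurable. [cite: DuminilCopinSmirnov2012Clay, §6.2] -/
theorem measurableSet_preimage_stoppedPrefix_singleton {ν : BondConfig (Site 2) → ℕ}
    (hν : ∀ m (ω₀ ω : BondConfig (Site 2)), ω ∈ explorationCylinder hD ω₀ m → (ν ω ≤ m ↔ ν ω₀ ≤ m))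
    (l : List MedialVertex) : MeasurableSet (stoppedPrefix D ν ⁻¹' {l}) := by
  by_cases h : ∃ ω₀, stoppedPrefix D ν ω₀ = l
  · obtain ⟨ω₀, rfl⟩ := h
    rw [preimage_stoppedPrefix_singleton hν]
    exact measurableSet_explorationCylinder ω₀ _
  · rw [Set.eq_empty_of_forall_notMem (s := stoppedPrefix D ν ⁻¹' {l}) fun ω hω ↦ h ⟨ω, hω⟩]
    exact MeasurableSet.empty

open scoped Classical in
/-- **The revealed set of a stopped prefix**: the revealed free edges of any configuration with
that stopped prefix (and `∅` for lists that are not stopped prefixes). [cite: DuminilCopinSmirnov2012Clay, §6.2] -/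
def stoppedRevealed (hD : D.IsZdAdmissible) (ν : BondConfig (Site 2) → ℕ) (l : List MedialVertex) :
    Set (Sym2 (Site 2)) :=
  if h : ∃ ω₀, stoppedPrefix D ν ω₀ = l then revealedFreeEdges hD h.choose (ν h.choose) else ∅

/-- The revealed set of the stopped prefix of `ω₀` is the set of revealed free edges of `ω₀` at
its stopping depth (class step). [cite: DuminilCopinSmirnov2012Clay, §6.2] -/
theorem stoppedRevealed_stoppedPrefix {ν : BondConfig (Site 2) → ℕ}
    (hν : ∀ m (ω₀ ω : BondConfig (Site 2)), ω ∈ explorationCylinder hD ω₀ m → (ν ω ≤ m ↔ ν ω₀ ≤ m))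
    (ω₀ : BondConfig (Site 2)) :
    stoppedRevealed hD ν (stoppedPrefix D ν ω₀) = revealedFreeEdges hD ω₀ (ν ω₀) := by
  classical
  have h : ∃ ω, stoppedPrefix D ν ω = stoppedPrefix D ν ω₀ := ⟨ω₀, rfl⟩
  rw [stoppedRevealed, dif_pos h]
  have hmem : h.choose ∈ explorationCylinder hD ω₀ (ν ω₀) := by
    rw [← preimage_stoppedPrefix_singleton hν ω₀]
    exact h.choose_spec
  rw [eq_of_stoppedPrefix_eq hν h.choose_spec, revealedFreeEdges_eq_of_mem hmem]

/-- **The fibres of the stopped past are determined by their revealed sets.**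
[cite: DuminilCopinSmirnov2012Clay, §6.2 (proof of Lemma 6.6)] -/
theorem determinedBy_preimage_stoppedPrefix {ν : BondConfig (Site 2) → ℕ}
    (hν : ∀ m (ω₀ ω : BondConfig (Site 2)), ω ∈ explorationCylinder hD ω₀ m → (ν ω ≤ m ↔ ν ω₀ ≤ m))
    (l : List MedialVertex) : DeterminedBy (stoppedPrefix D ν ⁻¹' {l}) (stoppedRevealed hD ν l) := by
  by_cases h : ∃ ω₀, stoppedPrefix D ν ω₀ = l
  · obtain ⟨ω₀, rfl⟩ := h
    rw [preimage_stoppedPrefix_singleton hν, stoppedRevealed_stoppedPrefix hν]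
    exact determinedBy_explorationCylinder ω₀ _
  · rw [Set.eq_empty_of_forall_notMem (s := stoppedPrefix D ν ⁻¹' {l}) fun ω hω ↦ h ⟨ω, hω⟩,
      determinedBy_iff]
    simp

/-! ### The single-scale conditional closing bound -/

/-- **The single-scale conditional closing bound at a class step** (Camia–Newman's "condition on
`Γ(γ)` at time `T`, then RSW": PTRF 139 (2007), proof of Lemma 7.1; for bond-`ℤ²` the domain
Markov property of the exploration in integrated form).  Let `ν` be a class step of the
exploration of admissible data, `T` a set of stopped prefixes, and `G ω₀` a "closing" event which
is a class function of the stopped past (`G ω = G ω₀` on `C_{ν ω₀}(ω₀)`), measurable, determined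
by the edges NOT revealed by the stopped past, and of `P_{1/2}`-probability `≥ q` whenever the
stopped prefix of `ω₀` lies in `T`.  If the event `E` forces `ω ∉ G ω` on `{stoppedPrefix ∈ T}`,
then `P ({stoppedPrefix ∈ T} ∩ E) ≤ (1 - q) · P {stoppedPrefix ∈ T}`.
[cite: CamiaNewman2007, §7 (proof of Lemma 7.1)] [cite: KemppainenSmirnov2017, §4.2] -/
theorem measure_inter_le_mul_of_closing_classStep {ν : BondConfig (Site 2) → ℕ}
    (hν : ∀ m (ω₀ ω : BondConfig (Site 2)), ω ∈ explorationCylinder hD ω₀ m → (ν ω ≤ m ↔ ν ω₀ ≤ m))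
    (G : BondConfig (Site 2) → Set (BondConfig (Site 2)))
    (hGclass : ∀ ω₀ ω, ω ∈ explorationCylinder hD ω₀ (ν ω₀) → G ω = G ω₀)
    (hGdet : ∀ ω₀, DeterminedBy (G ω₀) (revealedFreeEdges hD ω₀ (ν ω₀))ᶜ)
    (hGm : ∀ ω₀, MeasurableSet (G ω₀)) {T : Set (List MedialVertex)} {E : Set (BondConfig (Site 2))}
    {q : ℝ≥0∞} (hq : ∀ ω₀, stoppedPrefix D ν ω₀ ∈ T → q ≤ bondPercolation (zdGraph 2) half (G ω₀))
    (hE : ∀ ω ∈ E, stoppedPrefix D ν ω ∈ T → ω ∉ G ω) :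
    bondPercolation (zdGraph 2) half (stoppedPrefix D ν ⁻¹' T ∩ E) ≤
      (1 - q) * bondPercolation (zdGraph 2) half (stoppedPrefix D ν ⁻¹' T) := by
  classical
  -- the closing event as a function of the stopped prefix
  set G' : List MedialVertex → Set (BondConfig (Site 2)) := fun l ↦
    if h : ∃ ω₀, stoppedPrefix D ν ω₀ = l then G h.choose else Set.univ with hG'
  -- `G' (stoppedPrefix ω) = G ω`
  have hG'eq : ∀ ω, G' (stoppedPrefix D ν ω) = G ω := by
    intro ω
    have h : ∃ ω', stoppedPrefix D ν ω' = stoppedPrefix D ν ω := ⟨ω, rfl⟩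
    simp only [hG', dif_pos h]
    have hmem : h.choose ∈ explorationCylinder hD ω (ν ω) := by
      rw [← preimage_stoppedPrefix_singleton hν ω]
      exact h.choose_spec
    exact hGclass ω _ hmem
  have hG'det : ∀ l, DeterminedBy (G' l) (stoppedRevealed hD ν l)ᶜ := by
    intro l
    by_cases h : ∃ ω₀, stoppedPrefix D ν ω₀ = l
    · obtain ⟨ω₀, rfl⟩ := h
      rw [hG'eq, stoppedRevealed_stoppedPrefix hν]
      exact hGdet ω₀
    · simp only [hG', dif_neg h]
      exact determinedBy_univ _
  have hG'm : ∀ l, MeasurableSet (G' l) := by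
    intro l
    by_cases h : ∃ ω₀, stoppedPrefix D ν ω₀ = l
    · obtain ⟨ω₀, rfl⟩ := h
      rw [hG'eq]
      exact hGm ω₀
    · simp only [hG', dif_neg h]
      exact MeasurableSet.univ
  have key := measure_preimage_inter_le_mul_of_closing (stoppedPrefix D ν) (stoppedRevealed hD ν)
    (measurableSet_preimage_stoppedPrefix_singleton hν) (determinedBy_preimage_stoppedPrefix hν)
    G' hG'det hG'm (T := T ∩ range (stoppedPrefix D ν)) (E := E) (q := q)
    (by rintro l ⟨hl, ω₀, rfl⟩; rw [hG'eq]; exact hq ω₀ hl)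
    (by rintro ω hω ⟨hT, -⟩; rw [hG'eq]; exact hE ω hω hT)
  rwa [Set.preimage_inter_range] at key

end Regularity

/-- **Registered form** (anchor `regularity_measure_inter_le_mul_of_closing_classStep` of stmt-CriticalPhenomena-0746): the
single-scale conditional closing bound at a class step of the bond-`ℤ²` exploration — if a closing event that is a class
function of the stopped past, determined by the unrevealed edges and of probability `≥ q` on `{stoppedPrefix ∈ T}`, is absent
on `E ∩ {stoppedPrefix ∈ T}`, then `P ({stoppedPrefix ∈ T} ∩ E) ≤ (1 - q) · P {stoppedPrefix ∈ T}`.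
[cite: CamiaNewman2007, §7 (proof of Lemma 7.1)] -/
theorem regularity_measure_inter_le_mul_of_closing_classStep : ∀ {D : Literature.Probability.LatticeModels.DiscreteDobrushin} {hD : D.IsZdAdmissible} {ν : Literature.Probability.Percolation.BondConfig (Literature.Probability.LatticeModels.Site 2) → ℕ}, (∀ (m : ℕ) (ω₀ ω : Literature.Probability.Percolation.BondConfig (Literature.Probability.LatticeModels.Site 2)), ω ∈ Literature.Probability.LatticeModels.DiscreteDobrushin.explorationCylinder hD ω₀ m → (ν ω ≤ m ↔ ν ω₀ ≤ m)) → ∀ (G : Literature.Probability.Percolation.BondConfig (Literature.Probability.LatticeModels.Site 2) → Set (Literature.Probability.Percolation.BondConfig (Literature.Probability.LatticeModels.Site 2))), (∀ ω₀ ω, ω ∈ Literature.Probability.LatticeModels.DiscreteDobrushin.explorationCylinder hD ω₀ (ν ω₀) → G ω = G ω₀) → (∀ ω₀, Literature.Probability.Percolation.DeterminedBy (G ω₀) (Summit.CriticalPhenomena.CardyFormulaZ2.Cruxes.ParafermionToSLESixFamilies.CaratheodoryNetSlitUniformity.revealedFreeEdges hD ω₀ (ν ω₀))ᶜ) → (∀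 ω₀, MeasurableSet (G ω₀)) → ∀ {T : Set (List Literature.Probability.LatticeModels.MedialVertex)} {E : Set (Literature.Probability.Percolation.BondConfig (Literature.Probability.LatticeModels.Site 2))} {q : ENNReal}, (∀ ω₀, Summit.CriticalPhenomena.CardyFormulaZ2.Cruxes.CardyRigidity.CrossingMartingale.Regularity.stoppedPrefix D ν ω₀ ∈ T → q ≤ Literature.Probability.Percolation.bondPercolation (Literature.Probability.LatticeModels.zdGraph 2) Literature.Probability.Percolation.half (G ω₀)) → (∀ ω ∈ E, Summit.CriticalPhenomena.CardyFormulaZ2.Cruxes.CardyRigidity.CrossingMartingale.Regularity.stoppedPrefix D ν ω ∈ T → ω ∉ G ω) → Literature.Probability.Percolation.bondPercolation (Literature.Probability.LatticeModels.zdGraph 2) Literature.Probability.Percolation.half (Summit.CriticalPhenomena.CardyFormulaZ2.Cruxes.CardyRigidity.CrossingMartingale.Regularity.stoppedPrefix D ν ⁻¹' T ∩ E) ≤ (1 - q) * Literature.Probability.Percolation.bondPercolation (Literature.Probability.LatticeModels.zdGraph 2) Literature.Probability.Percolation.half (Summit.CriticalPhenomena.CardyFormulaZ2.Cruxes.CardyRigidity.CrossingMartingale.Regularity.stoppedPrefix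 D ν ⁻¹' T) :=
  fun hν G hGclass hGdet hGm _ _ _ hq hE ↦ Regularity.measure_inter_le_mul_of_closing_classStep hν G hGclass hGdet hGm hq hE

end Summit.CriticalPhenomena.CardyFormulaZ2.Cruxes.CardyRigidity.CrossingMartingale

end
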